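import Summits.HubbardSuperconductivity.HubbardSuperconductivity.Theses.InfiniteVolumeFirst
import Summits.HubbardSuperconductivity.HubbardSuperconductivity.Theorems.InfiniteVolumeFirstTightnessExchange
import Literature.MathematicalPhysics.QuantumLattice.BlockPairPlancherel
import Mathlib.Analysis.SpecialFunctions.Trigonometric.Bounds

/-!
# Crux `NoNormalLimitState` (stmt-HubbardSuperconductivity-18533, route `InfiniteVolumeFirst`),
# line `window-gap-transfer` — stub `stub_windowFloorAtom`

WINDOW FLOORS AT EVERY SCALE FORCE THE ATOM (the LOWER Fejér bound). For any family `ψ_L` of torus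
Fock vectors normalised at even sides and any `a > 0`: if for every window radius `ε > 0` the
`d`-wave pair structure factor carries weight `Σ_{|q_m| ≤ ε} S_{ψ_L}(m) ≥ a L²` at all large even
`L`, then every pointwise limit `C` of the translation-averaged pair correlations
`C_L(x) = L⁻² Σ_y G_L(x + y, y)` along a strictly increasing sequence of even sides satisfies
`liminf_R R⁻⁴ Σ_{x,y ∈ [0,R)²} C(x - y) ≥ a` (Bochner atom of the positive-definite limit `≥ a`).

Proof (harmonic analysis on `(ℤ/Lℤ)²`, no Hamiltonian):
* `norm_sum_stdAddChar_ge` — the one-dimensional block kernel `G(k) = Σ_{v<R} e(kv)` obeys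
  `‖G(k)‖ ≥ R - θ_k R²`, `θ_k = 2π|n_k|/L`, `n_k = valMinAbs k` (`|e^{iθv} - 1| ≤ θ v ≤ θ R`);
* `blockKernel_normSq_ge` — hence the box kernel `F_R(m) = Σ_{u ∈ [0,R)²} χ_m(u) = G(m₀) G(m₁)` has
  `‖F_R(m)‖² ≥ (1 - 4 ε R) R⁴` on the window `|q_m|² ≤ ε²` (both `θ ≤ ε`; Bernoulli);
* `windowSum_le_boxAvg` — the WINDOWED FEJÉR LOWER BOUND at a fixed side `L = n + 1`:
  `(1 - 4εR) · L⁻² Σ_{|q_m| ≤ ε} S_L(m) ≤ R⁻⁴ Σ_{x,y ∈ [0,R)²} C_L(x - y)` for every `R > 0`, `ε ≥ 0`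
  and EVERY vector (box double sum = block pair coherence `L⁻² Σ_a ‖B_a ψ‖²`,
  `tightnessExchange_boxSum_eq`; block Plancherel `L² Σ_a ‖B_a ψ‖² = Σ_m |F_R(m)|² ‖Δ_d(m)ψ‖²`,
  `sum_conjTranspose_block_mul_block`; drop the nonnegative off-window modes);
* `stub_windowFloorAtom` — let `j → ∞` in the finite box sums (`R` fixed, `ε ≤ 1/(4R)`), then
  `ε → 0⁺`: the `R`-th block average of `C` is `≥ a` for every `R ≥ 1`; `|C| ≤ C_d²`
  (`tightnessExchange_abs_corrAvg_le`) keeps the real `liminf` honest.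

Sources: Kennedy–Lieb–Shastry, PRL **61** (1988) 2582 (Fourier modes of an order operator, Parseval
sum rule); Friedli–Velenik (2017) §10.4; Stein–Shakarchi, *Fourier Analysis*, Ch. 2 (Fejér kernel).
Folklore finite-dimensional statements; no definition and no named fact is introduced.
-/

noncomputable section

-- the mandated namespace `Summit.<Summit>.<Problem>.Theorems` repeats `HubbardSuperconductivity`
-- (single-problem summit, D-0017), which the `dupNamespace` linter flags on every declaration
set_option linter.dupNamespace false

namespace Summit.HubbardSuperconductivity.HubbardSuperconductivity.Theorems.NoNormalLimitState

open Literature.MathematicalPhysics.QuantumLattice Literature.Probability.LatticeModels Matrix Finset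
  Filter
open scoped ComplexConjugate ComplexOrder Topology

/-! ### The one-dimensional block kernel: a lower bound -/

section Kernel

variable {L : ℕ} [NeZero L]

/-- **Lower bound for the one-dimensional block kernel.** With `n = valMinAbs k` and
`θ = 2π|n|/L ∈ [0, π]`: `‖Σ_{v<R} e(k v)‖ ≥ R - θ R²` (each term is `e^{iθv}` up to the sign of `n`,
and `|e^{iθv} - 1| ≤ θ v ≤ θ R`). Stein–Shakarchi, *Fourier Analysis*, Ch. 2. [folklore] -/
theorem norm_sum_stdAddChar_ge (k : ZMod L) (R : ℕ) :
    (R : ℝ) - 2 * Real.pi / L * |((k.valMinAbs : ℤ) : ℝ)| * (R : ℝ) ^ 2 ≤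
      ‖∑ v : Fin R, (ZMod.stdAddChar (k * ((v : ℕ) : ZMod L)) : ℂ)‖ := by
  have hL : (0 : ℝ) < L := Nat.cast_pos.2 (Nat.pos_of_ne_zero (NeZero.ne L))
  set θ : ℝ := 2 * Real.pi / L * |((k.valMinAbs : ℤ) : ℝ)| with hθ
  have hθ0 : 0 ≤ θ := by positivity
  -- each term is `exp (v • (2πi n/L))`
  have hterm : ∀ v : Fin R, (ZMod.stdAddChar (k * ((v : ℕ) : ZMod L)) : ℂ) =
      Complex.exp (((v : ℕ) : ℂ) * (2 * Real.pi * Complex.I * (k.valMinAbs : ℤ) / L)) := by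
    intro v
    rw [mul_comm k, ← nsmul_eq_mul, AddChar.map_nsmul_eq_pow, Complex.exp_nat_mul]
    congr 1
    have h := ZMod.stdAddChar_coe (N := L) k.valMinAbs
    rwa [ZMod.coe_valMinAbs] at h
  -- `|e^{ivθ'} - 1| ≤ |v θ'| = v θ ≤ R θ`
  have hdev : ∀ v : Fin R, ‖(ZMod.stdAddChar (k * ((v : ℕ) : ZMod L)) : ℂ) - 1‖ ≤ θ * R := by
    intro v
    rw [hterm]
    have hx : (((v : ℕ) : ℂ) * (2 * Real.pi * Complex.I * (k.valMinAbs : ℤ) / L)) =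
        Complex.I * (((v : ℕ) * (2 * Real.pi * (k.valMinAbs : ℤ) / L) : ℝ) : ℂ) := by
      push_cast
      ring
    rw [hx]
    refine le_trans Real.norm_exp_I_mul_ofReal_sub_one_le ?_
    rw [Real.norm_eq_abs, abs_mul, Nat.abs_cast]
    have hv : ((v : ℕ) : ℝ) ≤ R := by exact_mod_cast (v.2).le
    have habs : |2 * Real.pi * ((k.valMinAbs : ℤ) : ℝ) / L| = θ := by
      rw [hθ, abs_div, abs_mul, abs_of_pos (by positivity : (0 : ℝ) < 2 * Real.pi),
        abs_of_pos hL]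
      ring
    rw [habs, mul_comm]
    exact mul_le_mul_of_nonneg_left hv hθ0
  -- `G = R + Σ_v (e(kv) - 1)`
  have hsplit : ∑ v : Fin R, (ZMod.stdAddChar (k * ((v : ℕ) : ZMod L)) : ℂ) =
      (R : ℂ) + ∑ v : Fin R, ((ZMod.stdAddChar (k * ((v : ℕ) : ZMod L)) : ℂ) - 1) := by
    rw [Finset.sum_sub_distrib, Finset.sum_const, Finset.card_univ, Fintype.card_fin,
      nsmul_eq_mul, mul_one]
    ring
  have hsum : ‖∑ v : Fin R, ((ZMod.stdAddChar (k * ((v : ℕ) : ZMod L)) : ℂ) - 1)‖ ≤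
      θ * (R : ℝ) ^ 2 := by
    refine (norm_sum_le _ _).trans ?_
    calc ∑ v : Fin R, ‖(ZMod.stdAddChar (k * ((v : ℕ) : ZMod L)) : ℂ) - 1‖
        ≤ ∑ _v : Fin R, θ * R := Finset.sum_le_sum fun v _ => hdev v
      _ = θ * (R : ℝ) ^ 2 := by
          rw [Finset.sum_const, Finset.card_univ, Fintype.card_fin, nsmul_eq_mul]
          ring
  -- triangle inequality
  have htri : ‖(R : ℂ)‖ ≤ ‖∑ v : Fin R, (ZMod.stdAddChar (k * ((v : ℕ) : ZMod L)) : ℂ)‖ +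
      ‖∑ v : Fin R, ((ZMod.stdAddChar (k * ((v : ℕ) : ZMod L)) : ℂ) - 1)‖ := by
    have h := norm_sub_le (∑ v : Fin R, (ZMod.stdAddChar (k * ((v : ℕ) : ZMod L)) : ℂ))
      (∑ v : Fin R, ((ZMod.stdAddChar (k * ((v : ℕ) : ZMod L)) : ℂ) - 1))
    rwa [hsplit, add_sub_cancel_right, ← hsplit] at h
  rw [Complex.norm_natCast] at htri
  rw [hθ] at hsum
  linarith

/-- The box kernel factorises over the two coordinates:
`Σ_{u ∈ [0,R)²} χ_m(u) = (Σ_{v<R} e(m₀ v)) (Σ_{v<R} e(m₁ v))`. [folklore] -/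
theorem blockKernel_eq_mul (m : TorusSite 2 L) (R : ℕ) :
    ∑ u : Fin 2 → Fin R, torusChar m (fun i => ((u i : ℕ) : ZMod L)) =
      (∑ v : Fin R, (ZMod.stdAddChar (m 0 * ((v : ℕ) : ZMod L)) : ℂ)) *
        ∑ v : Fin R, (ZMod.stdAddChar (m 1 * ((v : ℕ) : ZMod L)) : ℂ) := by
  -- adapted from the private `blockKernel_eq_prod` of `WcbcsSsbToTorusLRO` (Fejér closure)
  have h : ∑ u : Fin 2 → Fin R, torusChar m (fun i => ((u i : ℕ) : ZMod L)) =
      ∏ i, ∑ v : Fin R, (ZMod.stdAddChar (m i * ((v : ℕ) : ZMod L)) : ℂ) := by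
    rw [Fintype.prod_sum]
    rfl
  rw [h, Fin.prod_univ_two]

omit [NeZero L] in
/-- A coordinate of a momentum label in the window `|q_m|² ≤ ε²` has phase `θ_i = 2π|n_i|/L ≤ ε`.
[folklore] -/
theorem phase_le_of_momentumNormSq_le (m : TorusSite 2 L) {ε : ℝ} (hε : 0 ≤ ε)
    (hm : momentumNormSq L m ≤ ε ^ 2) (i : Fin 2) :
    2 * Real.pi / L * |(((m i).valMinAbs : ℤ) : ℝ)| ≤ ε := by
  have h1 : (2 * Real.pi / L * |(((m i).valMinAbs : ℤ) : ℝ)|) ^ 2 ≤ momentumNormSq L m := by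
    rw [momentumNormSq_apply, mul_pow, sq_abs]
    refine mul_le_mul_of_nonneg_left ?_ (sq_nonneg _)
    exact Finset.single_le_sum (f := fun j => ((((m j).valMinAbs : ℤ) : ℝ)) ^ 2)
      (fun j _ => sq_nonneg _) (Finset.mem_univ i)
  exact (pow_le_pow_iff_left₀ (by positivity) hε two_ne_zero).1 (h1.trans hm)

/-- **Lower bound for the box kernel on the window**: for `ε ≥ 0` and `|q_m|² ≤ ε²`,
`(1 - 4 ε R) R⁴ ≤ ‖F_R(m)‖²`, `F_R(m) = Σ_{u ∈ [0,R)²} χ_m(u)` (both one-dimensional kernels are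
`≥ R(1 - εR)`; if `4εR > 1` the bound is trivial, otherwise `(1 - εR)⁴ ≥ 1 - 4εR`).
Stein–Shakarchi, *Fourier Analysis*, Ch. 2. [folklore] -/
theorem blockKernel_normSq_ge (m : TorusSite 2 L) (R : ℕ) {ε : ℝ} (hε : 0 ≤ ε)
    (hm : momentumNormSq L m ≤ ε ^ 2) :
    (1 - 4 * ε * R) * (R : ℝ) ^ 4 ≤
      ‖∑ u : Fin 2 → Fin R, torusChar m (fun i => ((u i : ℕ) : ZMod L))‖ ^ 2 := by
  by_cases hsmall : 4 * ε * R ≤ 1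
  · -- both one-dimensional kernels are at least `R (1 - ε R) ≥ 0`
    have hcoord : ∀ i : Fin 2, (R : ℝ) * (1 - ε * R) ≤
        ‖∑ v : Fin R, (ZMod.stdAddChar (m i * ((v : ℕ) : ZMod L)) : ℂ)‖ := by
      intro i
      have h := norm_sum_stdAddChar_ge (m i) R
      have hph := phase_le_of_momentumNormSq_le m hε hm i
      have : 2 * Real.pi / L * |(((m i).valMinAbs : ℤ) : ℝ)| * (R : ℝ) ^ 2 ≤ ε * (R : ℝ) ^ 2 :=
        mul_le_mul_of_nonneg_right hph (by positivity)
      nlinarith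
    have hnn : 0 ≤ (R : ℝ) * (1 - ε * R) := by
      refine mul_nonneg (Nat.cast_nonneg R) ?_
      nlinarith
    rw [blockKernel_eq_mul, norm_mul, mul_pow]
    have h0 := hcoord 0
    have h1 := hcoord 1
    have hsq0 : ((R : ℝ) * (1 - ε * R)) ^ 2 ≤
        ‖∑ v : Fin R, (ZMod.stdAddChar (m 0 * ((v : ℕ) : ZMod L)) : ℂ)‖ ^ 2 :=
      pow_le_pow_left₀ hnn h0 2
    have hsq1 : ((R : ℝ) * (1 - ε * R)) ^ 2 ≤
        ‖∑ v : Fin R, (ZMod.stdAddChar (m 1 * ((v : ℕ) : ZMod L)) : ℂ)‖ ^ 2 :=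
      pow_le_pow_left₀ hnn h1 2
    have hprod : ((R : ℝ) * (1 - ε * R)) ^ 2 * ((R : ℝ) * (1 - ε * R)) ^ 2 ≤
        ‖∑ v : Fin R, (ZMod.stdAddChar (m 0 * ((v : ℕ) : ZMod L)) : ℂ)‖ ^ 2 *
          ‖∑ v : Fin R, (ZMod.stdAddChar (m 1 * ((v : ℕ) : ZMod L)) : ℂ)‖ ^ 2 :=
      mul_le_mul hsq0 hsq1 (by positivity) (by positivity)
    refine le_trans ?_ hprod
    -- Bernoulli: `(1 - 4x) ≤ (1 - x)⁴` for `x = εR ∈ [0, 1/4]`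
    have hx0 : 0 ≤ ε * R := by positivity
    have hx1 : ε * R ≤ 1 := by nlinarith
    have hb : (1 - 4 * ε * R) ≤ (1 - ε * R) ^ 4 := by nlinarith [sq_nonneg (ε * R), sq_nonneg (1 - ε * R)]
    calc (1 - 4 * ε * R) * (R : ℝ) ^ 4 ≤ (1 - ε * R) ^ 4 * (R : ℝ) ^ 4 :=
          mul_le_mul_of_nonneg_right hb (by positivity)
      _ = ((R : ℝ) * (1 - ε * R)) ^ 2 * ((R : ℝ) * (1 - ε * R)) ^ 2 := by ring
  · have hneg : (1 - 4 * ε * R) * (R : ℝ) ^ 4 ≤ 0 :=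
      mul_nonpos_of_nonpos_of_nonneg (by linarith) (by positivity)
    exact hneg.trans (sq_nonneg _)

end Kernel

/-! ### The windowed Fejér lower bound at a fixed side -/

/-- **Windowed Fejér lower bound.** For any family `ψ`, any side `L = n + 1`, any block scale
`R > 0` and any `ε ≥ 0`:
`(1 - 4εR) · L⁻² Σ_{|q_m|² ≤ ε²} S_L(m) ≤ R⁻⁴ Σ_{x,y ∈ [0,R)²} C_L(x - y)`, where
`C_L(z) = L⁻² Σ_w G_L(z + w, w)` is the translation-averaged pair correlation and
`S_L = pairStructureFactor`: the box double sum is block pair coherence, block Plancherel has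
nonnegative Fejér weights `|F_R(m)|²`, and on the window `|F_R(m)|² ≥ (1 - 4εR) R⁴`.
Kennedy–Lieb–Shastry, PRL 61 (1988) 2582; Friedli–Velenik (2017) §10.4. [folklore] -/
theorem windowSum_le_boxAvg (ψ : ∀ L, Fock (Orb (FermionTorus 2 L))) (n R : ℕ) (hR : 0 < R)
    {ε : ℝ} (hε : 0 ≤ ε) :
    (1 - 4 * ε * R) * ((∑ m : TorusSite 2 (n + 1), if momentumNormSq (n + 1) m ≤ ε ^ 2 then
        pairStructureFactor dWaveFormFactor (n + 1) (ψ (n + 1)) m else 0) / ((n + 1 : ℕ) : ℝ) ^ 2) ≤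
      (∑ x ∈ halfOpenBox 2 R, ∑ y ∈ halfOpenBox 2 R,
        (∑ w ∈ halfOpenBox 2 (n + 1),
          torusPullback (pairFieldCorr dWaveFormFactor ψ) (n + 1) (x - y + w) w) /
            ((n + 1 : ℕ) : ℝ) ^ 2) / (R : ℝ) ^ 4 := by
  classical
  rw [tightnessExchange_boxSum_eq]
  have hRpos : (0 : ℝ) < R := Nat.cast_pos.2 hR
  have hLpos : (0 : ℝ) < ((n + 1 : ℕ) : ℝ) := Nat.cast_pos.2 (Nat.succ_pos n)
  -- abbreviations
  set φ := ψ (n + 1) with hφ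
  set F : TorusSite 2 (n + 1) → ℂ := fun m =>
    ∑ u : Fin 2 → Fin R, torusChar m fun i => ((u i : ℕ) : ZMod (n + 1)) with hF
  set T : TorusSite 2 (n + 1) → ℝ := fun m =>
    (star φ ⬝ᵥ (((pairFieldAt dWaveFormFactor (n + 1) m)ᴴ * pairFieldAt dWaveFormFactor (n + 1) m) *ᵥ
      φ)).re with hT
  -- block Plancherel, scalar form: `L² Σ_a ‖B_a φ‖² = Σ_m |F m|² T m`
  have hplan := congrArg (fun M => (star φ ⬝ᵥ (M *ᵥ φ)).re)
    (sum_conjTranspose_block_mul_block (L := n + 1) dWaveFormFactor R)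
  have hL2 : ((n + 1 : ℕ) : ℂ) ^ 2 = ((((n + 1 : ℕ) : ℝ) ^ 2 : ℝ) : ℂ) := by push_cast; rfl
  simp only [hL2, Matrix.smul_mulVec, dotProduct_smul, Matrix.sum_mulVec, dotProduct_sum,
    smul_eq_mul, Complex.re_sum, Complex.re_ofReal_mul] at hplan
  have hterm : ∀ m : TorusSite 2 (n + 1),
      ((conj (∑ u : Fin 2 → Fin R, torusChar m fun i => ((u i : ℕ) : ZMod (n + 1))) *
          ∑ u : Fin 2 → Fin R, torusChar m fun i => ((u i : ℕ) : ZMod (n + 1))) *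
        (star φ ⬝ᵥ (((pairFieldAt dWaveFormFactor (n + 1) m)ᴴ *
          pairFieldAt dWaveFormFactor (n + 1) m) *ᵥ φ))).re = ‖F m‖ ^ 2 * T m := by
    intro m
    rw [Complex.conj_mul', ← Complex.ofReal_pow, Complex.re_ofReal_mul]
  simp only [hterm] at hplan
  -- the modes are nonnegative and `T m = L² S_L(m)`
  have hTnn : ∀ m, 0 ≤ T m := fun m => by
    simp only [hT, ← star_mulVec_dotProduct_mulVec]
    exact (Complex.nonneg_iff.1 (dotProduct_star_self_nonneg _)).1
  have hTS : ∀ m, T m = ((n + 1 : ℕ) : ℝ) ^ 2 * pairStructureFactor dWaveFormFactor (n + 1) φ m := by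
    intro m
    rw [pairStructureFactor_apply, star_mulVec_dotProduct_mulVec,
      mul_div_cancel₀ _ (pow_ne_zero 2 hLpos.ne')]
  -- keep only the window and bound the kernel there from below
  have hwin : (1 - 4 * ε * R) * (R : ℝ) ^ 4 * ∑ m : TorusSite 2 (n + 1),
      (if momentumNormSq (n + 1) m ≤ ε ^ 2 then T m else 0) ≤ ∑ m, ‖F m‖ ^ 2 * T m := by
    rw [Finset.mul_sum]
    refine Finset.sum_le_sum fun m _ => ?_
    split_ifs with hm
    · exact mul_le_mul_of_nonneg_right (blockKernel_normSq_ge m R hε hm) (hTnn m)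
    · rw [mul_zero]
      exact mul_nonneg (sq_nonneg _) (hTnn m)
  rw [← hplan] at hwin
  -- rewrite the block coherence in vector form
  have hvec : (∑ a : TorusSite 2 (n + 1), (star φ ⬝ᵥ (((∑ u : Fin 2 → Fin R,
      localPair dWaveFormFactor (n + 1) (a + fun i => ((u i : ℕ) : ZMod (n + 1))))ᴴ *
      (∑ u : Fin 2 → Fin R,
        localPair dWaveFormFactor (n + 1) (a + fun i => ((u i : ℕ) : ZMod (n + 1))))) *ᵥ φ)).re) =
      ∑ a : TorusSite 2 (n + 1), (star ((∑ u : Fin 2 → Fin R,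
        localPair dWaveFormFactor (n + 1) (a + fun i => ((u i : ℕ) : ZMod (n + 1)))) *ᵥ φ) ⬝ᵥ
        ((∑ u : Fin 2 → Fin R,
          localPair dWaveFormFactor (n + 1) (a + fun i => ((u i : ℕ) : ZMod (n + 1)))) *ᵥ φ)).re :=
    Finset.sum_congr rfl fun a _ => by rw [star_mulVec_dotProduct_mulVec]
  rw [hvec] at hwin
  -- the window sum in terms of `S_L`
  have hWS : ∑ m : TorusSite 2 (n + 1), (if momentumNormSq (n + 1) m ≤ ε ^ 2 then T m else 0) =
      ((n + 1 : ℕ) : ℝ) ^ 2 * ∑ m : TorusSite 2 (n + 1), (if momentumNormSq (n + 1) m ≤ ε ^ 2 then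
        pairStructureFactor dWaveFormFactor (n + 1) φ m else 0) := by
    rw [Finset.mul_sum]
    refine Finset.sum_congr rfl fun m _ => ?_
    split_ifs
    · exact hTS m
    · rw [mul_zero]
  rw [hWS] at hwin
  -- assemble
  set W : ℝ := ∑ m : TorusSite 2 (n + 1), (if momentumNormSq (n + 1) m ≤ ε ^ 2 then
    pairStructureFactor dWaveFormFactor (n + 1) φ m else 0) with hW
  set Bsum : ℝ := ∑ a : TorusSite 2 (n + 1), (star ((∑ u : Fin 2 → Fin R,
        localPair dWaveFormFactor (n + 1) (a + fun i => ((u i : ℕ) : ZMod (n + 1)))) *ᵥ φ) ⬝ᵥ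
        ((∑ u : Fin 2 → Fin R,
          localPair dWaveFormFactor (n + 1) (a + fun i => ((u i : ℕ) : ZMod (n + 1)))) *ᵥ φ)).re
    with hBsum
  rw [Complex.re_sum, div_div, le_div_iff₀ (by positivity)]
  have hkey : (1 - 4 * ε * R) * (R : ℝ) ^ 4 * (((n + 1 : ℕ) : ℝ) ^ 2 * W) ≤
      ((n + 1 : ℕ) : ℝ) ^ 2 * Bsum := hwin
  have hcalc : (1 - 4 * ε * R) * (W / ((n + 1 : ℕ) : ℝ) ^ 2) * (((n + 1 : ℕ) : ℝ) ^ 2 * (R : ℝ) ^ 4) =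
      ((1 - 4 * ε * R) * (R : ℝ) ^ 4 * (((n + 1 : ℕ) : ℝ) ^ 2 * W)) / ((n + 1 : ℕ) : ℝ) ^ 2 := by
    field_simp
  rw [hcalc, div_le_iff₀ (by positivity)]
  calc (1 - 4 * ε * R) * (R : ℝ) ^ 4 * (((n + 1 : ℕ) : ℝ) ^ 2 * W)
      ≤ ((n + 1 : ℕ) : ℝ) ^ 2 * Bsum := hkey
    _ = Bsum * ((n + 1 : ℕ) : ℝ) ^ 2 := by ring

/-! ### The stub -/

/-- **Stub `windowFloorAtom` of line `window-gap-transfer` — WINDOW FLOORS AT EVERY SCALE FORCE THE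
ATOM.** For any family `ψ` of torus Fock vectors normalised at even sides and any `a > 0`: if for
every `ε > 0` the window pair weight satisfies `Σ_{|q_m| ≤ ε} S_{ψ_L}(m) ≥ a L²` for all large even
`L` (threshold depending on `ε`), then every pointwise limit `C` of the translation-averaged
`d`-wave pair correlations along a strictly increasing sequence of even sides has
`liminf_R R⁻⁴ Σ_{x,y ∈ [0,R)²} C(x − y) ≥ a`. Proof: the windowed Fejér lower bound
`R⁻⁴ Σ_{x,y∈[0,R)²} C_L(x−y) ≥ (1 − 4εR) L⁻² Σ_{|q_m|≤ε} S_L(m) ≥ (1 − 4εR) a` at every large even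
side passes to the limit `j → ∞` in the finite box sums; then `ε → 0⁺` gives `≥ a` for every
`R ≥ 1`, and `|C| ≤ C_d²` bounds the sequence. Kennedy–Lieb–Shastry, PRL 61 (1988) 2582;
Friedli–Velenik (2017) §10.4; Stein–Shakarchi Ch. 2 (Fejér kernel). [folklore] -/
theorem stub_windowFloorAtom :
    ∀ (ψ : ∀ L, Fock (Orb (FermionTorus 2 L))) (a : ℝ), 0 < a →
      (∀ L, Even L → star (ψ L) ⬝ᵥ ψ L = 1) →
      (∀ ε : ℝ, 0 < ε → ∃ L₀ : ℕ, ∀ (L : ℕ) [NeZero L], Even L → L₀ ≤ L →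
        a * (L : ℝ) ^ 2 ≤ ∑ m : TorusSite 2 L,
          if momentumNormSq L m ≤ ε ^ 2 then pairStructureFactor dWaveFormFactor L (ψ L) m else 0) →
      ∀ (Ls : ℕ → ℕ) (C : Site 2 → ℝ), StrictMono Ls → (∀ j, Even (Ls j)) →
        (∀ x : Site 2, Tendsto (fun j : ℕ => (∑ y ∈ halfOpenBox 2 (Ls j),
          torusPullback (pairFieldCorr dWaveFormFactor ψ) (Ls j) (x + y) y) / ((Ls j : ℕ) : ℝ) ^ 2)
          atTop (𝓝 (C x))) →
        a ≤ liminf (fun R : ℕ => (∑ x ∈ halfOpenBox 2 R, ∑ y ∈ halfOpenBox 2 R, C (x - y)) /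
          ((R : ℕ) : ℝ) ^ 4) atTop := by
  intro ψ a ha hnorm hfloor Ls C hLs hLs_even hconv
  -- the constant `C_d²` bounding `|C_L|` and hence `|C|`
  obtain ⟨B, hB⟩ : ∃ B : ℝ, B = (∑ e ∈ insert (0 : Site 2) unitSteps,
      ‖((dWaveFormFactor e / Real.sqrt 2 : ℝ) : ℂ)‖ * 2) ^ 2 := ⟨_, rfl⟩
  have hB0 : 0 ≤ B := by rw [hB]; positivity
  -- the block averages of the limit
  obtain ⟨b, hb⟩ : ∃ b : ℕ → ℝ, ∀ R, b R = (∑ x ∈ halfOpenBox 2 R, ∑ y ∈ halfOpenBox 2 R,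
      C (x - y)) / ((R : ℕ) : ℝ) ^ 4 := ⟨_, fun _ => rfl⟩
  -- Step 1: for `R > 0` and `ε > 0`, `(1 - 4εR) a ≤ b R` provided `4 ε R ≤ 1`
  have hstep : ∀ R : ℕ, 0 < R → ∀ ε : ℝ, 0 < ε → 4 * ε * R ≤ 1 → (1 - 4 * ε * R) * a ≤ b R := by
    intro R hR ε hε hεR
    have hbj : Tendsto (fun j => (∑ x ∈ halfOpenBox 2 R, ∑ y ∈ halfOpenBox 2 R,
        (∑ w ∈ halfOpenBox 2 (Ls j), torusPullback (pairFieldCorr dWaveFormFactor ψ) (Ls j)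
          (x - y + w) w) / ((Ls j : ℕ) : ℝ) ^ 2) / ((R : ℕ) : ℝ) ^ 4) atTop (𝓝 (b R)) := by
      rw [hb]
      exact (tendsto_finsetSum _ fun x _ => tendsto_finsetSum _ fun y _ => hconv (x - y)).div_const _
    refine ge_of_tendsto hbj ?_
    obtain ⟨L₀, hL₀⟩ := hfloor ε hε
    filter_upwards [hLs.tendsto_atTop.eventually_ge_atTop (max L₀ 1)] with j hj
    obtain ⟨n, hn⟩ : ∃ n, Ls j = n + 1 := ⟨Ls j - 1, by omega⟩
    have hevn : Even (n + 1) := hn ▸ hLs_even j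
    have hfl := hL₀ (n + 1) hevn (by omega)
    have hfl' : a ≤ (∑ m : TorusSite 2 (n + 1), if momentumNormSq (n + 1) m ≤ ε ^ 2 then
        pairStructureFactor dWaveFormFactor (n + 1) (ψ (n + 1)) m else 0) / ((n + 1 : ℕ) : ℝ) ^ 2 := by
      rw [le_div_iff₀ (by positivity)]
      exact hfl
    rw [hn]
    refine le_trans ?_ (windowSum_le_boxAvg ψ n R hR hε.le)
    exact mul_le_mul_of_nonneg_left hfl' (by linarith)
  -- Step 2: `ε → 0⁺` gives `a ≤ b R` for every `R > 0`
  have hbR : ∀ R : ℕ, 0 < R → a ≤ b R := by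
    intro R hR
    have hRpos : (0 : ℝ) < R := Nat.cast_pos.2 hR
    have hcont : Tendsto (fun ε : ℝ => (1 - 4 * ε * R) * a) (𝓝[>] 0) (𝓝 a) := by
      have hc : Continuous fun ε : ℝ => (1 - 4 * ε * R) * a := by fun_prop
      have h := hc.tendsto' 0 a (by simp)
      exact tendsto_nhdsWithin_of_tendsto_nhds h
    refine le_of_tendsto hcont ?_
    have hmem : Set.Ioo (0 : ℝ) (1 / (4 * R)) ∈ 𝓝[>] (0 : ℝ) := Ioo_mem_nhdsGT (by positivity)
    filter_upwards [hmem] with ε hε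
    rw [Set.mem_Ioo] at hε
    refine hstep R hR ε hε.1 ?_
    have h := hε.2.le
    rw [le_div_iff₀ (by positivity)] at h
    linarith
  -- Step 3: `|C| ≤ B`, so `b` is bounded above and the liminf is not a junk value
  have hCbd : ∀ x, |C x| ≤ B := fun x => by
    refine le_of_tendsto ((continuous_abs.tendsto _).comp (hconv x)) ?_
    filter_upwards [hLs.tendsto_atTop.eventually_ge_atTop 0] with j _
    simp only [Function.comp_apply, hB]
    exact tightnessExchange_abs_corrAvg_le ψ _ (hnorm _ (hLs_even j)) x
  have hb_up : ∀ R, b R ≤ B := by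
    intro R
    have habs : |b R| ≤ B := by
      rw [hb, abs_div, abs_of_nonneg (by positivity : (0 : ℝ) ≤ ((R : ℕ) : ℝ) ^ 4)]
      rcases Nat.eq_zero_or_pos R with rfl | hRpos
      · simpa using hB0
      · rw [div_le_iff₀ (by positivity)]
        calc |∑ x ∈ halfOpenBox 2 R, ∑ y ∈ halfOpenBox 2 R, C (x - y)|
            ≤ ∑ x ∈ halfOpenBox 2 R, |∑ y ∈ halfOpenBox 2 R, C (x - y)| :=
              Finset.abs_sum_le_sum_abs _ _
          _ ≤ ∑ x ∈ halfOpenBox 2 R, ∑ y ∈ halfOpenBox 2 R, |C (x - y)| :=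
              Finset.sum_le_sum fun x _ => Finset.abs_sum_le_sum_abs _ _
          _ ≤ ∑ x ∈ halfOpenBox 2 R, ∑ y ∈ halfOpenBox 2 R, B :=
              Finset.sum_le_sum fun x _ => Finset.sum_le_sum fun y _ => hCbd _
          _ = B * ((R : ℕ) : ℝ) ^ 4 := by
              rw [Finset.sum_const, Finset.sum_const, card_halfOpenBox, smul_smul, nsmul_eq_mul]
              push_cast
              ring
    exact (abs_le.1 habs).2
  -- Step 4: conclude
  have hfun : (fun R : ℕ => (∑ x ∈ halfOpenBox 2 R, ∑ y ∈ halfOpenBox 2 R, C (x - y)) /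
      ((R : ℕ) : ℝ) ^ 4) = b := funext fun R => (hb R).symm
  rw [hfun]
  exact le_liminf_of_le (isCoboundedUnder_ge_of_le atTop hb_up)
    ((eventually_gt_atTop 0).mono fun R hR => hbR R hR)

end Summit.HubbardSuperconductivity.HubbardSuperconductivity.Theorems.NoNormalLimitState

end
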